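import Summits.BirchSwinnertonDyer.Rank1Residual.ManinAdditive.CuspidalKummerClass
import Literature.NumberTheory.EllipticCurves.ManinConstantGamma1Gamma0Comparison
import HarnessLib
import HarnessLib.Audit.Tags

/-!
# Candidates E-an-66 / 67 / 68 / 69 / 70 and the blind-residual split of C2 — the Γ₀(N)/Γ₁(N) LEDGER on the
# blind residual (an g16, MEMO-an §58) — cell `bsd-f2-manin` (D-0131 (3) frontier: the Manin constant at additive
# primes)

HONEST FRAMING.  LENS = analytic / period-lattice (planner `bsd-f2-manin-an`, g16; HOME
`run/shared/lean/pub/bsd-f2-manin/MEMO-an-58.md` 7f3afa5c46452753 «THE Γ₀/Γ₁ LEDGER ON THE BLIND RESIDUAL»).  Source: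
HOME/an/Sketch-an-g16.lean sha16 **3421a0eefa50b65e** (farm rc 0), namespace `…Cruxes.ManinOddAtFour.ShimuraLedger` ↦
`…ManinAdditive.ShimuraLedger`, declarations VERBATIM with three leaf-hygiene edits: (i) the route import
`…Theses.ManinLocalTwoThree` is dropped (no declaration used it); (ii) E-an-71 `AtMostOneBlindRoot` is NOT re-declared —
it is a TREE THEOREM (`Theorems/ManinLocalTwoThreeAtMostOneBlindRoot.lean`, p618249); (iii) the printed F-need
`ExistsOptimalGamma1Datum` is vendored in Literature as `exists_optimal_gamma1ParametrizationData` (typer, p623346,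
Conrad–Edixhoven–Stein 2003 §6.1 / Stevens 1989 §2) and enters the transfer edge as an explicit hypothesis; `@[conjecture]`
is added to the nine law / residual rows.  Vocabulary (all in tree): `ModularParametrizationData W N` (the
`X₀(N)`-optimality clause spelled `∀ z ∈ D.L.lattice, ∃ w ∈ periodLattice D.f, z = D.c * w`), `Gamma1ParametrizationData W N`
+ `IsOptimal` (Stevens' `X₁(N)`-optimal curve; ČNS Lemma 6.5 file), `periodLattice f = Λ₀(f)`, `periodLatticeGamma1 f = Λ₁(f)`,
`IsIsogenous`, and the cell's blindness predicate `CuspidalKummer.KummerBlindAtTwo a₂ a₄ e` (E-an-50/54: `T = (e, 0)` is BLIND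
iff the 2-isogeny `ψ_T` is not étale).  Note: `HasRationalTwoTorsion` here is the ROOT form for models with `a₁ = a₃ = 0`
(a rational root of `x³ + a₂x² + a₄x + a₆`); the desc planner's `ConwayCut.HasRationalTwoTorsion` is the group-law form —
different namespaces, equivalent on such models.

REFUTER VERDICTS: REF1 §R55 = R-an-31 (2026-08-28T09:51:07Z; report HOME/ref1/R55-ref1-ang16-g17.md c274d3d19125c095; kernel
HOME/ref1-C63-ang16g17-audit.lean b4486526c9f311ee = g16 + g17 VERBATIM + `RefAudit63`, farm rc 0; probes 18/18 CLEAN): **ALL ROWS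
SURVIVE, 0 killed, 0 mis-typed** — E-an-66/67 theorem-candidates modulo exactly TWO printed statement-only facts not in the
tree (F1 = ČNS Lemma 6.5 in its EXACT form `c₀ = n_θ · c₁`, the tree has `cesnaviciusNeururerSaha_lemma_6_5_dvd` only; F2 =
«`Σ(N)` is μ-type and `ker θ̂ ⊂ Σ(N)`», Ling–Oesterlé 1991 Thm 1 + Stevens §2 / Vatsal 2005 Rem. 1.8) plus the tree theorem
`2Λ₀ ⊆ Λ₁ ⊆ Λ₀` at `4 ∣ N`; **E-an-68 TRUE on paper from in-tree ingredients alone** (`L₁ = c₁Λ₁ = 2c₁Λ₀ = (2c₁/c₀)L₀`,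
`IsNeronLatticeOf` pins `(c₄, c₆)` so they scale by `λ⁻⁴, λ⁻⁶` ⇒ `W₁ ≅_ℚ W₀` ⇒ both minimal ⇒ `λ¹² = 1` ⇒ `c₀ = ±2c₁`; `_holds`
target ~40 l. after a `PeriodPair` homogeneity lemma); E-an-69/70 are C2 / C2¹ INSTANCES on the explicit family (open; binders
inhabited: `isElliptic_blindCurve m`, all members globally minimal by Tate at 2, witnesses 20a1 (m = 1), 52a1 (m = −3), 116c1
(m = 5), 212b1 (m = −7), …; vacuous by design where `E′_m` is not `X₀`-optimal); E-an-71 PROVED in tree; the `Rb` split and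
the transfer edge re-elaborated, axioms standard; `ExistsOptimalGamma1Datum` an F-need (now p623346).  CENSUS (BC5): HOME/an/
g16-isogeny-tree.out 3fc406c503ccc849 + refuter-1 engine 2 R55-e55blind.out d96a2221c878ff34 (1 302 564 curves with `4 ∣ N`;
the totally blind `X₀`-optimal curves `< 5·10⁵` are EXACTLY the 89 curves `E′_m`; `c₀ = 1` on all 89; blind-root histogram
{0: 946 313, 1: 356 251, ≥ 2: 0}).  REF2 R-an-31 (b) placement: pending at filing (imc g15 placement (a)(b)(c) confirmed by
refuter-1 at page level: Yazdani §3.5 / Thm 3.8 case 4 / p. 15 «we expect … do not yet know of a proof»).  bears_on: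
stmt-BirchSwinnertonDyer-22967 (C2 `ManinOddAtFour`, stub 6 `Rb` of `Lines/kato_shift_two.lean`).  PARTITION 0 · beyond-print
theorem: no · BSD is not proved by this; Manin's conjecture is not proved by this.
-/

set_option autoImplicit false

noncomputable section

open Literature.NumberTheory.EllipticCurves Literature.NumberTheory.EllipticCurves.ModularForms
open WeierstrassCurve
open Summit.BirchSwinnertonDyer.Rank1Residual.ManinAdditive.CuspidalKummer

namespace Summit.BirchSwinnertonDyer.Rank1Residual.ManinAdditive.ShimuraLedger

/-! ### The explicit family (census §58.D: the 89 totally blind optimal curves, `4 ∣ N < 5·10⁵`) -/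

/-- `E_m : y² = x³ + m x² − x` (`Δ = 16(m² + 4)`; the 2-SOURCE of its class; `T₁ = (0,0)` is NON-blind for every `m`;
in Cremona's table it carries `c₀ = 2` and is the `X₁(N)`-side curve, `[Λ₀:Λ₁] = 2`, es E15 49/49). -/
def sourceCurve (m : ℤ) : WeierstrassCurve ℚ := ⟨0, m, 0, -1, 0⟩

/-- `E'_m = E_m/⟨(0,0)⟩ : y² = x³ − 2m x² + (m² + 4) x` (`Δ = −256(m² + 4)²`, cofactor discriminant `−16`, so
`E'_m(ℚ)[2] = ℤ/2` and its generator `(0,0)` is BLIND for every `m`): for `m` odd with `m² + 4` prime this is the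
`X₀(N)`-optimal curve, `N = 4(m²+4)` (`m ≡ 1 mod 4`, Kodaira IV*) or `16(m²+4)` (`m ≡ 3 mod 4`, I₀*); plus
`m = 0` (32a1) and `m = ±2` (128b1, 128d1).  `E'_{−m} ≅ E'_m ⊗ χ₋₁`. -/
def blindCurve (m : ℤ) : WeierstrassCurve ℚ := ⟨0, -2 * m, 0, m ^ 2 + 4, 0⟩

/-- The rational 2-torsion point `(0,0)` of `E'_m` is BLIND, for every `m` (witnesses `−m`, `−1`). (an g16, PROVED.) -/
theorem kummerBlindAtTwo_blindCurve (m : ℤ) : KummerBlindAtTwo (-2 * m) (m ^ 2 + 4) 0 := by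
  refine ⟨⟨-m, by ring⟩, ⟨-1, by ring⟩⟩

/-- For odd `m` the point `(0,0)` of `E_m` is NOT blind (`2 ∤ a₂ + e = m`). (an g16, PROVED.) -/
theorem not_kummerBlindAtTwo_sourceCurve_of_odd {m : ℤ} (hm : Odd m) : ¬ KummerBlindAtTwo m (-1) 0 := by
  rintro ⟨h, -⟩
  rw [add_zero] at h
  exact (Int.not_even_iff_odd.mpr hm) h

/-- `(0,0)` of `E_0` (32a) is not blind. (an g16, PROVED.) -/
theorem not_kummerBlindAtTwo_sourceCurve_zero : ¬ KummerBlindAtTwo 0 (-1) 0 := by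
  rintro ⟨-, h⟩; norm_num at h

/-- `(0,0)` of `E_2` (128b/d) is not blind. (an g16, PROVED.) -/
theorem not_kummerBlindAtTwo_sourceCurve_two : ¬ KummerBlindAtTwo 2 (-1) 0 := by
  rintro ⟨-, h⟩; norm_num at h

/-- `(0,0)` of `E_{−2}` is not blind. (an g16, PROVED.) -/
theorem not_kummerBlindAtTwo_sourceCurve_neg_two : ¬ KummerBlindAtTwo (-2) (-1) 0 := by
  rintro ⟨-, h⟩; norm_num at h

/-! ### Blindness of the rational 2-torsion of a model `y² = x³ + a₂x² + a₄x + a₆` -/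

/-- Every rational 2-torsion point `(e,0)` of `W` (a model with `a₁ = a₃ = 0`) is blind, with integer witnesses
(for a globally minimal such model `a₂, a₄, a₆ ∈ ℤ` and a rational root is an integer).  Vacuous when `W(ℚ)[2] = 0`. -/
def AllRationalTwoTorsionBlind (W : WeierstrassCurve ℚ) : Prop :=
  ∀ e : ℚ, e ^ 3 + W.a₂ * e ^ 2 + W.a₄ * e + W.a₆ = 0 →
    ∃ A₂ A₄ E : ℤ, (A₂ : ℚ) = W.a₂ ∧ (A₄ : ℚ) = W.a₄ ∧ (E : ℚ) = e ∧ KummerBlindAtTwo A₂ A₄ E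

/-- `W` has a NON-blind rational 2-torsion point `(e,0)`. -/
def HasNonBlindRationalTwoTorsion (W : WeierstrassCurve ℚ) : Prop :=
  ∃ e : ℚ, e ^ 3 + W.a₂ * e ^ 2 + W.a₄ * e + W.a₆ = 0 ∧
    ∀ A₂ A₄ E : ℤ, (A₂ : ℚ) = W.a₂ → (A₄ : ℚ) = W.a₄ → (E : ℚ) = e → ¬ KummerBlindAtTwo A₂ A₄ E

/-- `W` has a rational 2-torsion point (reducible `W[2]`; the locus `Rb` of stub 6 of `Lines/kato_shift_two.lean`). -/
def HasRationalTwoTorsion (W : WeierstrassCurve ℚ) : Prop :=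
  ∃ e : ℚ, e ^ 3 + W.a₂ * e ^ 2 + W.a₄ * e + W.a₆ = 0

/-- Dichotomy (pure logic): either every rational 2-torsion point is blind, or some rational 2-torsion point is
non-blind. (an g16, PROVED.) -/
theorem allBlind_or_hasNonBlind (W : WeierstrassCurve ℚ) :
    AllRationalTwoTorsionBlind W ∨ HasNonBlindRationalTwoTorsion W := by
  classical
  by_cases h : HasNonBlindRationalTwoTorsion W
  · exact Or.inr h
  · refine Or.inl fun e he => ?_
    by_contra hne
    apply h
    refine ⟨e, he, fun A₂ A₄ E h₂ h₄ hE hb => hne ⟨A₂, A₄, E, h₂, h₄, hE, hb⟩⟩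

/-! ### E-an-66 / E-an-67: the Γ₀/Γ₁ ledger at `4 ∣ N` -/

/-- **Candidate E-an-66 `TotallyBlindGammaOneTransfer` (THEOREM-candidate modulo printed facts; nothing asserted).**
For `4 ∣ N`, an `X₀(N)`-optimal globally minimal `W₀` written with `a₁ = a₃ = 0` all of whose rational 2-torsion
points are BLIND (in particular: `W₀(ℚ)[2] = 0`, or `W₀(ℚ)[2] = ℤ/2` blind = the residual of the §56 Kummer
certificate), and the `X₁(N)`-optimal curve `W₁` of its class: `|c₀| = |c₁|`.
Paper proof: `W₀ ∩ Σ(N) ⊂ W₀(ℚ)[2]` (Ling–Oesterlé / Vatsal Rem. 1.8; tree: `2Λ₀ ⊆ Λ₁ ⊆ Λ₀` at `4 ∣ N`), so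
`θ : W₁ = W₀/(W₀ ∩ Σ) → W₀` has degree `s = [Λ₀:Λ₁] ∈ {1,2,4}` and `c₀ = n_θ · c₁` (ČNS Lemma 6.5, exact form);
`s = 4` needs full rational 2-torsion, impossible when all rational 2-torsion is blind (E-an-71); `s = 2`: `θ = ±ψ̂_T`
with `T` the rational 2-torsion point, blind ⟹ `n_{ψ_T} = 2` (E-an-54) ⟹ `n_θ = 2/n_{ψ_T} = 1`; `s = 1`: `W₁ = W₀`.
Why it might fail: only through a mis-transcription of ČNS 6.5's isogeny `e` (degree `[Λ₀:Λ₁]`) — the tree holds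
only `c₁ ∣ c₀`.  [conjecture — cell candidate, NOT a tree fact] [cite: CesnaviciusNeururerSaha2023, Lemma 6.5 (p. 42) (shape only: the tree holds `c₁ ∣ c₀`; the blind-transfer equality is the cell's row E-an-66, NOT in print — MEMO-an §58, refuter-1 §R55)] -/
@[conjecture]
def TotallyBlindGammaOneTransfer : Prop :=
  ∀ (W₁ W₀ : WeierstrassCurve ℚ) [W₁.IsElliptic] [W₁.IsGloballyMinimal] [W₀.IsElliptic] [W₀.IsGloballyMinimal]
    {N : ℕ} [NeZero N] (D₁ : Gamma1ParametrizationData W₁ N) (D₀ : ModularParametrizationData W₀ N),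
    IsIsogenous W₁ W₀ → D₁.IsOptimal → (∀ z ∈ D₀.L.lattice, ∃ w ∈ periodLattice D₀.f, z = D₀.c * w) →
    2 ^ 2 ∣ N → W₀.a₁ = 0 → W₀.a₃ = 0 → AllRationalTwoTorsionBlind W₀ →
    D₀.maninConstant.natAbs = D₁.maninConstant.natAbs

/-- **Candidate E-an-67 `ShimuraLedgerAtFour` (THEOREM-candidate modulo printed facts; nothing asserted).**
Same setting without the blindness hypothesis: `|c₀| = |c₁|`, or `|c₀| = 2|c₁|` AND `W₀` has a NON-blind rational
2-torsion point (the generator of `ker(W₀ → W₁)`; for `s = 4` one of the three).  In words: `ord₂ c₀ = ord₂ c₁ + ε`,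
`ε ∈ {0,1}`, and `ε = 1` only on the locus where the §56 cuspidal Kummer certificate has a point to work with.
[conjecture — cell candidate, NOT a tree fact] [cite: CesnaviciusNeururerSaha2023, Lemma 6.5 (p. 42) (shape only: the ledger `|c₀| ∈ {|c₁|, 2|c₁|}` with the non-blind clause is the cell's row E-an-67, NOT in print — MEMO-an §58, refuter-1 §R55)] -/
@[conjecture]
def ShimuraLedgerAtFour : Prop :=
  ∀ (W₁ W₀ : WeierstrassCurve ℚ) [W₁.IsElliptic] [W₁.IsGloballyMinimal] [W₀.IsElliptic] [W₀.IsGloballyMinimal]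
    {N : ℕ} [NeZero N] (D₁ : Gamma1ParametrizationData W₁ N) (D₀ : ModularParametrizationData W₀ N),
    IsIsogenous W₁ W₀ → D₁.IsOptimal → (∀ z ∈ D₀.L.lattice, ∃ w ∈ periodLattice D₀.f, z = D₀.c * w) →
    2 ^ 2 ∣ N → W₀.a₁ = 0 → W₀.a₃ = 0 →
    D₀.maninConstant.natAbs = D₁.maninConstant.natAbs ∨
      (D₀.maninConstant.natAbs = 2 * D₁.maninConstant.natAbs ∧ HasNonBlindRationalTwoTorsion W₀)

/-- E-an-67 ⟹ E-an-66 (pure logic: a curve all of whose rational 2-torsion is blind has no non-blind one). -/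
theorem totallyBlindGammaOneTransfer_of_ledger (h : ShimuraLedgerAtFour) : TotallyBlindGammaOneTransfer := by
  intro W₁ W₀ _ _ _ _ N _ D₁ D₀ hiso h₁ h₀ h4 ha₁ ha₃ hblind
  rcases h W₁ W₀ D₁ D₀ hiso h₁ h₀ h4 ha₁ ha₃ with heq | ⟨-, e, he, hnb⟩
  · exact heq
  · obtain ⟨A₂, A₄, E, h₂, h₄, hE, hb⟩ := hblind e he
    exact (hnb A₂ A₄ E h₂ h₄ hE hb).elim

/-! ### E-an-68: index 4 forces an even Manin constant (in-tree provable candidate) -/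

/-- **Candidate E-an-68 `GammaOneIndexFourForcesEvenManin` (THEOREM-candidate, in-tree ingredients only; nothing
asserted).**  If `Λ₁(f) = 2Λ₀(f)` (index 4, the extreme case allowed by Ling–Oesterlé at `4 ∣ N`) then `2 ∣ c₀`:
`Λ_{W₁} = c₁Λ₁ = 2c₁Λ₀ = (2c₁/c₀)Λ_{W₀}`, a RATIONAL homothety, so `W₁ ≅_ℚ W₀` and both minimal ⟹ `2c₁ = ±c₀`.
Contrapositive = a necessary condition for C2 (`2 ∤ c₀ ⟹ [Λ₀(f):Λ₁(f)] ≤ 2`), PASSED by es E15 (index ∈ {1,2,3},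
never 4 or 9, 1069/1069 classes `N ≤ 80153`).  [conjecture — cell candidate, NOT a tree fact] [cite: CesnaviciusNeururerSaha2023, Lemma 6.5 (p. 42) (shape only: row E-an-68 is TRUE on paper from in-tree ingredients, refuter-1 §R55 — `_holds` target ~40 l. after a `PeriodPair` homogeneity lemma)] -/
@[conjecture]
def GammaOneIndexFourForcesEvenManin : Prop :=
  ∀ (W₁ W₀ : WeierstrassCurve ℚ) [W₁.IsElliptic] [W₁.IsGloballyMinimal] [W₀.IsElliptic] [W₀.IsGloballyMinimal]
    {N : ℕ} [NeZero N] (D₁ : Gamma1ParametrizationData W₁ N) (D₀ : ModularParametrizationData W₀ N),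
    D₁.IsOptimal → (∀ z ∈ D₀.L.lattice, ∃ w ∈ periodLattice D₀.f, z = D₀.c * w) →
    (∀ z : ℂ, z ∈ periodLatticeGamma1 D₁.f ↔ ∃ w ∈ periodLattice D₀.f, z = 2 * w) →
    (2 : ℤ) ∣ D₀.maninConstant

/-! ### E-an-69 / E-an-70: C2 on the explicit blind family -/

/-- **Candidate E-an-69 `ManinOddBlindFamily` (= C2 restricted to the family `E'_m`; OPEN; nothing asserted).**
Whenever `E'_m : y² = x³ − 2m x² + (m²+4)x` is a globally minimal `X₀(N)`-optimal curve, its Manin constant is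
odd.  BC5 witness: the 89 optimal members with `N < 5·10⁵` (`m` odd, `m² + 4` prime; `m ∈ {0, ±2}`) all have
`c₀ = 1` (Cremona `opt_man`), and they are ALL the totally blind optimal curves with `4 ∣ N` in that range (census
§58.D, two engines, 0 missing, 0 extra).  Why it might fail: it is Manin's conjecture on an infinite family with
additive potentially good reduction at 2 (IV*, I₀*) and reducible `E[2]` — outside Mazur/Abbes–Ullmo/Česnavičius
and outside the §56 certificate.  [conjecture — cell candidate, NOT a tree fact] [cite: Yazdani2009, Thm. 3.8 case 4 and p. 15 (shape only: the family is printed parity-side; the Manin statement on it is the cell's row E-an-69 = an instance of Manin's `c = 1`, OPEN)] -/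
@[conjecture]
def ManinOddBlindFamily : Prop :=
  ∀ (m : ℤ) [(blindCurve m).IsElliptic] [(blindCurve m).IsGloballyMinimal] {N : ℕ} [NeZero N]
    (D : ModularParametrizationData (blindCurve m) N),
    (∀ z ∈ D.L.lattice, ∃ w ∈ periodLattice D.f, z = D.c * w) → ¬ (2 : ℤ) ∣ D.maninConstant

/-- **Candidate E-an-70 `GammaOneManinOddSourceFamily` (OPEN; nothing asserted).**  Whenever
`E_m : y² = x³ + m x² − x` is Stevens' `X₁(N)`-optimal curve of its class (es E15: it is, 49/49 in range), its
`Γ₁(N)`-Manin constant `c₁` is odd (CES 2003 Conj. 6.1.7 predicts `c₁ = 1`).  By E-an-66 this is EQUIVALENT to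
E-an-69 on the classes concerned; it is the form the Kato/`V_ℤ(f)` road and an `X₁(N)`-cuspidal Kummer
certificate (non-blind `T₁ = (0,0)`) would prove.  [conjecture — cell candidate, NOT a tree fact] [cite: ConradEdixhovenStein2003, §6.1 Conj. 6.1.7 (shape only: `c₁ = 1` for optimal quotients of `J₁(N)` is the printed CES expectation; the row E-an-70 is its instance on the family, OPEN)] -/
@[conjecture]
def GammaOneManinOddSourceFamily : Prop :=
  ∀ (m : ℤ) [(sourceCurve m).IsElliptic] [(sourceCurve m).IsGloballyMinimal] {N : ℕ} [NeZero N]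
    (D₁ : Gamma1ParametrizationData (sourceCurve m) N),
    D₁.IsOptimal → ¬ (2 : ℤ) ∣ D₁.maninConstant

/-! ### E-an-71 `AtMostOneBlindRoot` is a TREE THEOREM (`Summits/…/Theorems/ManinLocalTwoThreeAtMostOneBlindRoot.lean`,
p618249, `…Theorems.ManinLocalTwoThree.atMostOneBlindRoot`; refuter-1 RB63 `atMostOneBlindRoot_holds`): on a globally minimal model
with `a₁ = a₃ = 0` two distinct rational 2-torsion points are never both blind.  Not re-declared here (leaf hygiene: no
`Theorems/` import); E-an-66's paper proof uses it for the case `s = 4`. -/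

/-! ### The split of the reducible residual `Rb` of C2 (stub 6 of `Lines/kato_shift_two.lean`) -/

/-- C2 on the reducible locus, models with `a₁ = a₃ = 0` (every globally minimal curve with `4 ∣ N` has one):
`Rb` without the orbit-minimality side conditions of stub 6 (they only shrink it). [cite: Cremona2022ManinConstants, Table (shape only: `c = 1` for all optimal curves `N < 5·10⁵`; the row is C2 restricted to reducible `W[2]`, OPEN)] -/
@[conjecture]
def RbReducible : Prop :=
  ∀ (W : WeierstrassCurve ℚ) [W.IsElliptic] [W.IsGloballyMinimal] {N : ℕ} [NeZero N]
    (D : ModularParametrizationData W N),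
    (∀ z ∈ D.L.lattice, ∃ w ∈ periodLattice D.f, z = D.c * w) → 2 ^ 2 ∣ N → W.a₁ = 0 → W.a₃ = 0 →
    HasRationalTwoTorsion W → ¬ (2 : ℤ) ∣ D.maninConstant

/-- `Rb ∖ blind`: the target of the §56 cuspidal Kummer certificate (K_geo ∧ E-an-53 ⟹ this, via E-an-47/48/49⁺). [cite: Cremona2022ManinConstants, Table (shape only: as for `RbReducible`; the non-blind part is the target of the §56 cuspidal Kummer certificate)] -/
@[conjecture]
def RbNonBlind : Prop :=
  ∀ (W : WeierstrassCurve ℚ) [W.IsElliptic] [W.IsGloballyMinimal] {N : ℕ} [NeZero N]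
    (D : ModularParametrizationData W N),
    (∀ z ∈ D.L.lattice, ∃ w ∈ periodLattice D.f, z = D.c * w) → 2 ^ 2 ∣ N → W.a₁ = 0 → W.a₃ = 0 →
    HasNonBlindRationalTwoTorsion W → ¬ (2 : ℤ) ∣ D.maninConstant

/-- The BLIND residual: reducible `W[2]`, every rational 2-torsion point blind (census: `W(ℚ)[2] = ℤ/2` then, and in
range `N < 5·10⁵` these are exactly the 89 curves `E'_m`). [cite: Cremona2022ManinConstants, Table (shape only: the 89 totally blind optimal curves `N < 5·10⁵` all have `c₀ = 1`; OPEN beyond)] -/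
@[conjecture]
def RbTotallyBlind : Prop :=
  ∀ (W : WeierstrassCurve ℚ) [W.IsElliptic] [W.IsGloballyMinimal] {N : ℕ} [NeZero N]
    (D : ModularParametrizationData W N),
    (∀ z ∈ D.L.lattice, ∃ w ∈ periodLattice D.f, z = D.c * w) → 2 ^ 2 ∣ N → W.a₁ = 0 → W.a₃ = 0 →
    HasRationalTwoTorsion W → AllRationalTwoTorsionBlind W → ¬ (2 : ℤ) ∣ D.maninConstant

/-- DECOMPOSITION (kernel-checked): `Rb = (Rb ∖ blind) ∪ (totally blind)`. -/
theorem rbReducible_of_split (hnb : RbNonBlind) (hb : RbTotallyBlind) : RbReducible := by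
  intro W _ _ N _ D hopt h4 ha₁ ha₃ hT
  rcases allBlind_or_hasNonBlind W with hall | hnon
  · exact hb W D hopt h4 ha₁ ha₃ hT hall
  · exact hnb W D hopt h4 ha₁ ha₃ hnon

/-! `ExistsOptimalGamma1Datum` (an g16: existence of Stevens' `X₁(N)`-optimal curve with an optimal `Γ₁(N)`-datum in the
class of any `X₀(N)`-optimal curve) is a PRINTED fact, vendored by the cell typer in Literature as the named fact
`Literature.NumberTheory.EllipticCurves.ModularForms.exists_optimal_gamma1ParametrizationData` (APPEND to
`ManinConstantGamma1Gamma0Comparison.lean`, p623346, Conrad–Edixhoven–Stein 2003 §6.1 / Stevens 1989 §2); it is not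
re-declared in this leaf — the transfer edge below takes the statement as an explicit hypothesis `hex`, to be fed that
fact by name. -/

/-- `C2¹` on the blind classes: the `Γ₁(N)`-Manin constant of the `X₁`-optimal curve of a class whose `X₀`-optimal
curve is totally blind is odd (what the Kato/`V_ℤ(f)` road natively outputs — Λ₁-integrality — and what an
`X₁(N)`-Kummer certificate at the NON-blind point `T₁ ∈ ker(W₁ → W₀)` would certify).  OPEN. [cite: ConradEdixhovenStein2003, §6.1 Conj. 6.1.7 (shape only: `C2¹` on the blind classes is an instance of the CES expectation `c₁ = 1`, OPEN)] -/
@[conjecture]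
def GammaOneOddOnBlindClasses : Prop :=
  ∀ (W₁ W₀ : WeierstrassCurve ℚ) [W₁.IsElliptic] [W₁.IsGloballyMinimal] [W₀.IsElliptic] [W₀.IsGloballyMinimal]
    {N : ℕ} [NeZero N] (D₁ : Gamma1ParametrizationData W₁ N) (D₀ : ModularParametrizationData W₀ N),
    IsIsogenous W₁ W₀ → D₁.IsOptimal → (∀ z ∈ D₀.L.lattice, ∃ w ∈ periodLattice D₀.f, z = D₀.c * w) →
    2 ^ 2 ∣ N → W₀.a₁ = 0 → W₀.a₃ = 0 → HasRationalTwoTorsion W₀ → AllRationalTwoTorsionBlind W₀ →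
    ¬ (2 : ℤ) ∣ D₁.maninConstant

/-- TRANSFER EDGE (kernel-checked): blind transfer + existence of the `X₁`-optimal datum + `C2¹` on blind classes
⟹ the blind residual of C2.  So the blind residual is a `Γ₁(N)`-statement: `H2` ("Shimura cover étale at 2") is
AUTOMATIC on it. -/
theorem rbTotallyBlind_of_transfer (ht : TotallyBlindGammaOneTransfer)
    (hex : ∀ (W₀ : WeierstrassCurve ℚ) [W₀.IsElliptic] [W₀.IsGloballyMinimal] {N : ℕ} [NeZero N]
      (D₀ : ModularParametrizationData W₀ N),
      (∀ z ∈ D₀.L.lattice, ∃ w ∈ periodLattice D₀.f, z = D₀.c * w) →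
      ∃ (W₁ : WeierstrassCurve ℚ) (_ : W₁.IsElliptic) (_ : W₁.IsGloballyMinimal)
        (D₁ : Gamma1ParametrizationData W₁ N), IsIsogenous W₁ W₀ ∧ D₁.IsOptimal)
    (h₁ : GammaOneOddOnBlindClasses) : RbTotallyBlind := by
  intro W₀ _ _ N _ D₀ hopt h4 ha₁ ha₃ hT hall
  obtain ⟨W₁, i₁, i₂, D₁, hiso, hD₁⟩ := hex W₀ D₀ hopt
  have heq := ht W₁ W₀ D₁ D₀ hiso hD₁ hopt h4 ha₁ ha₃ hall
  have hodd := h₁ W₁ W₀ D₁ D₀ hiso hD₁ hopt h4 ha₁ ha₃ hT hall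
  intro hdvd
  apply hodd
  have : (2 : ℤ).natAbs ∣ D₁.maninConstant.natAbs := by
    rw [← heq]; exact Int.natAbs_dvd_natAbs.mpr hdvd
  exact Int.natAbs_dvd_natAbs.mp this

/-- The necessary condition read off E-an-68 (kernel-checked contrapositive): C2 for `D₀` forbids index 4. -/
theorem index_ne_four_of_maninOdd (h : GammaOneIndexFourForcesEvenManin)
    (W₁ W₀ : WeierstrassCurve ℚ) [W₁.IsElliptic] [W₁.IsGloballyMinimal] [W₀.IsElliptic] [W₀.IsGloballyMinimal]
    {N : ℕ} [NeZero N] (D₁ : Gamma1ParametrizationData W₁ N) (D₀ : ModularParametrizationData W₀ N)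
    (h₁ : D₁.IsOptimal) (h₀ : ∀ z ∈ D₀.L.lattice, ∃ w ∈ periodLattice D₀.f, z = D₀.c * w)
    (hodd : ¬ (2 : ℤ) ∣ D₀.maninConstant) :
    ¬ (∀ z : ℂ, z ∈ periodLatticeGamma1 D₁.f ↔ ∃ w ∈ periodLattice D₀.f, z = 2 * w) :=
  fun hidx => hodd (h W₁ W₀ D₁ D₀ h₁ h₀ hidx)

end Summit.BirchSwinnertonDyer.Rank1Residual.ManinAdditive.ShimuraLedger

end
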